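import Literature.NumberTheory.PAdicHodge.AinfRamifiedTorsionLift
import Literature.NumberTheory.PAdicHodge.AinfWeierstrassOmegaPeriod
import Literature.NumberTheory.PAdicHodge.BdRPlusFieldCoeff
import Literature.NumberTheory.EllipticCurves.FormalGroup
import HarnessLib

/-!
# The ω-period `∫_t ω = log_Ŵ(ι_𝒪[t]) ∈ Fil¹ B_dR⁺(F)` of a Tate-module point of the formal group of a Weierstrass equation
# over the ramified base `𝒪_D = ℤ_p[ϖ]`, and its `Γ_F`-equivariance

Topic `Literature/NumberTheory/PAdicHodge`; the ramified twin of `AinfWeierstrassOmegaPeriod` (case `𝒪 = ℤ_p`, `W/ℤ`), assembly of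
`AinfRamifiedTorsionLift` (Fontaine's element `[t] = lim [pⁿ]_W(ûₙ) ∈ ker θ_𝒪 ⊂ A_inf(𝒪)`), `AinfRamifiedComplete`/`AinfRamified`
(`ι_𝒪 : A_inf(𝒪) → B_dR⁺`, `ι_𝒪(ker θ_𝒪) ⊆ Fil¹`) and `BdRPlusFieldCoeff` (evaluation of `F`-power series on `Fil¹ B_dR⁺`).
For a Weierstrass equation `W` over `𝒪_D = ℤ_p[X]/(f)` (coefficients pushed to `F` by `𝒪_D → F`, `X ↦ ϖ`), a prime `p`, the
`p`-adic field `F ∋ ϖ` and `t ∈ T_p Ŵ(𝒪_{ℂ_F})` (`[p] t_{n+1} = t_n`, `t₀ = 0`):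

* `logSeries W ∈ F⟦T⟧` — the formal logarithm of `W ×_{𝒪_D} F` (Silverman AEC IV.5.5) over the discrete coefficient field
  `FieldCoeff hp hθ`;
* `torsionLiftFil W t` — the image `ι_𝒪([t]) ∈ Fil¹ B_dR⁺` (`θ_𝒪([t]) = 0`, `ker θ_𝒪 = ω A_inf(𝒪) ↦ (ξ_dR)`);
* **`omegaPeriod W t := log_W(ι_𝒪[t]) ∈ B_dR⁺(F)`** — the `p`-adic period of the invariant differential of `W` along `t`
  (Fontaine 1982 §5; Colmez 1992 §2), the `ξ`-adically convergent evaluation of `log_W ∈ F⟦T⟧` at `ι_𝒪[t] ∈ Fil¹`; it lies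
  in `Fil¹ B_dR⁺` (`omegaPeriod_mem_filOne`);
* **`gal_omegaPeriod : σ(∫_t ω) = ∫_{σ t} ω`** for every `σ ∈ Γ_F`.

Additivity in `t` (needs AEC IV.2.3 over `𝒪_D`), `ℤ_p`-linearity, boundedness and the non-vanishing (N1′) are the next steps
(`Cruxes/StarredOptimalManinUnitFiveSeven/Lines/kato-lever-hDR-R1-ring.md` §3) and are NOT proved here. Definitions (reviewed):
`coeffToF`, `logSeries`, `torsionLiftFil`, `omegaPeriod`. No named facts, no `sorry`. BSD / K★: infrastructure for the
supersingular sector of hDR over a ramified base; nothing about elliptic curves over number fields is proved here.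

## References
* J.-M. Fontaine, *Formes différentielles et modules de Tate des variétés abéliennes sur les corps locaux*, Invent. Math. 65
  (1982), §5 (the period pairing of a formal group). [Fontaine1982FormesDifferentielles]
* J.-M. Fontaine, *Le corps des périodes p-adiques*, Astérisque 223 (1994), Exp. II §1.5.4. [FontaineAsterisque223III]
* J. H. Silverman, *The Arithmetic of Elliptic Curves* (2009), IV.5.5 (`log_𝓕`). [SilvermanAEC2009]
-/

noncomputable section

open Ideal Field WittVector MvPowerSeries ValuativeRel

namespace Literature.NumberTheory.PAdicHodge

open Literature.NumberTheory.GaloisRepresentations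
open Literature.NumberTheory.GaloisRepresentations.IsNonarchimedeanLocalField
open Literature.NumberTheory.GaloisRepresentations.LubinTate

variable {F : Type} [Field F] [ValuativeRel F] [TopologicalSpace F] [IsNonarchimedeanLocalField F] [CharZero F]
  {p : ℕ} [Fact p.Prime] {hp : valuation F p < 1} {D : EisensteinRoot F p hp}

namespace EisensteinRoot

/-- `𝒪_D → F` on the discrete copy: `X ↦ ϖ`. [cite: SerreLocalFields1979, Ch. I §6 Prop. 18] -/
def CoeffDisc.toF (D : EisensteinRoot F p hp) : CoeffDisc D →+* F := (Coeff.toF D).comp (CoeffDisc.of D).symm.toRingHom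

/-- Unfolding `CoeffDisc.toF`. [cite: SerreLocalFields1979, Ch. I §6 Prop. 18] -/
theorem CoeffDisc.toF_of (D : EisensteinRoot F p hp) (x : D.Coeff) : CoeffDisc.toF D (CoeffDisc.of D x) = Coeff.toF D x := rfl

end EisensteinRoot

namespace AinfRamTop

variable [Fact (¬ IsUnit (p : integerC F))] [IsAdicComplete (Ideal.span {(p : integerC F)}) (integerC F)]
  {hθ : Function.Surjective (fontaineTheta (integerC F) p)} (W : WeierstrassCurve (EisensteinRoot.CoeffDisc D))

variable (hθ) in
/-- **The formal logarithm `log_W ∈ F⟦T⟧`** of `W ×_{𝒪_D} F` (Silverman AEC IV.5.5), as a series over the discrete coefficient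
field `FieldCoeff hp hθ`. [cite: SilvermanAEC2009, IV.5.5] -/
def logSeries : PowerSeries (FieldCoeff hp hθ) :=
  PowerSeries.map (FieldCoeff.of hp hθ).toRingHom (W.map (EisensteinRoot.CoeffDisc.toF D)).formalLog

/-- `log_W(0) = 0`. [cite: SilvermanAEC2009, IV.5.5] -/
theorem constantCoeff_logSeries : PowerSeries.constantCoeff (logSeries hθ W) = 0 := by
  rw [logSeries, ← PowerSeries.coeff_zero_eq_constantCoeff_apply, PowerSeries.coeff_map,
    PowerSeries.coeff_zero_eq_constantCoeff_apply, WeierstrassCurve.constantCoeff_formalLog, map_zero]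

/-- `ι_𝒪[t] ∈ Fil¹ B_dR⁺ = (ξ_dR)` (`θ_𝒪([t]) = 0`). [cite: FontaineAsterisque223III, Exp. II §1.5.2] -/
theorem toBdR_torsionLift_mem_filOne {t : ℕ → (maxNilIdealC F).toIdeal} (ht0 : (t 0 : CBall F) = 0)
    (htp : ∀ n, mulPC W (t (n + 1)) = t n) :
    BdRPlusTop.of F p (AinfRam.toBdR D hθ ((of D).symm (torsionLift W hθ t htp))) ∈ (BdRPlusTop.filOne F p).toIdeal := by
  rw [BdRPlusTop.mem_filOne_iff]
  refine AinfRam.toBdR_mem_span_xiBdR D hθ ?_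
  have h := theta_torsionLift W (hθ := hθ) ht0 htp
  have h' := congrArg (fun z : CBall F => (z : CompletedAlgClosure F)) h
  simp only [ZeroMemClass.coe_zero] at h'
  exact Subtype.ext h'

/-- **`ι_𝒪[t]` as an element of `Fil¹ B_dR⁺ = (ξ_dR)`.** [cite: FontaineAsterisque223III, Exp. II §1.5.2] -/
def torsionLiftFil (hθ : Function.Surjective (fontaineTheta (integerC F) p)) (t : ℕ → (maxNilIdealC F).toIdeal)
    (ht0 : (t 0 : CBall F) = 0) (htp : ∀ n, mulPC W (t (n + 1)) = t n) : (BdRPlusTop.filOne F p).toIdeal :=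
  ⟨BdRPlusTop.of F p (AinfRam.toBdR D hθ ((of D).symm (torsionLift W hθ t htp))), toBdR_torsionLift_mem_filOne W ht0 htp⟩

/-- Unfolding `torsionLiftFil`. [cite: FontaineAsterisque223III, Exp. II §1.5.2] -/
theorem coe_torsionLiftFil {t : ℕ → (maxNilIdealC F).toIdeal} (ht0 : (t 0 : CBall F) = 0)
    (htp : ∀ n, mulPC W (t (n + 1)) = t n) :
    (torsionLiftFil W hθ t ht0 htp : BdRPlusTop F p) = BdRPlusTop.of F p (AinfRam.toBdR D hθ ((of D).symm (torsionLift W hθ t htp))) :=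
  rfl

/-- **The ω-period `∫_t ω := log_W(ι_𝒪[t]) ∈ B_dR⁺(F)`** of the Tate-module point `t` of `Ŵ(𝒪_{ℂ_F})`, for `W` over the
ramified base `𝒪_D`: the formal logarithm evaluated, `ξ`-adically, at the image of Fontaine's element in `Fil¹`.
[cite: Fontaine1982FormesDifferentielles, §5] [cite: SilvermanAEC2009, IV.5.5] -/
def omegaPeriod (hθ : Function.Surjective (fontaineTheta (integerC F) p)) (t : ℕ → (maxNilIdealC F).toIdeal)
    (ht0 : (t 0 : CBall F) = 0) (htp : ∀ n, mulPC W (t (n + 1)) = t n) : BdRPlusTop F p :=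
  (evalPt₁ (BdRPlusTop.filOne F p) (logSeries hθ W) (constantCoeff_logSeries W) (torsionLiftFil W hθ t ht0 htp) :
    BdRPlusTop F p)

/-- **`∫_t ω ∈ Fil¹ B_dR⁺`** (`log_W` has no constant term and `ι_𝒪[t] ∈ Fil¹`). [cite: Fontaine1982FormesDifferentielles, §5] -/
theorem omegaPeriod_mem_filOne {t : ℕ → (maxNilIdealC F).toIdeal} (ht0 : (t 0 : CBall F) = 0)
    (htp : ∀ n, mulPC W (t (n + 1)) = t n) :
    omegaPeriod W hθ t ht0 htp ∈ (BdRPlusTop.filOne F p).toIdeal :=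
  (evalPt₁ (BdRPlusTop.filOne F p) (logSeries hθ W) (constantCoeff_logSeries W) (torsionLiftFil W hθ t ht0 htp)).2

/-- `σ(ι_𝒪[t]) = ι_𝒪[σ t]` in `Fil¹ B_dR⁺`. [cite: FontaineAsterisque223III, Exp. II §1.5] -/
theorem gal_torsionLiftFil (σ : absoluteGaloisGroup F) {t : ℕ → (maxNilIdealC F).toIdeal} (ht0 : (t 0 : CBall F) = 0)
    (htp : ∀ n, mulPC W (t (n + 1)) = t n) :
    BdRPlusTop.gal F p σ (torsionLiftFil W hθ t ht0 htp : BdRPlusTop F p) =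
      (torsionLiftFil W hθ (AinfTop.galSeq F σ t) (AinfTop.coe_galSeq_zero σ ht0) (mulPC_galSeq W hθ σ htp) : BdRPlusTop F p) := by
  rw [coe_torsionLiftFil, coe_torsionLiftFil, BdRPlusTop.gal_of, AinfRam.galBdRPlus_toBdR, ← gal_torsionLift W σ htp]
  rfl

/-- **`Γ_F`-equivariance of the ω-period over the ramified base: `σ(∫_t ω) = ∫_{σ t} ω`.**
[cite: Fontaine1982FormesDifferentielles, §5] [cite: FontaineAsterisque223III, Exp. II §1.5.4] -/
theorem gal_omegaPeriod (σ : absoluteGaloisGroup F) {t : ℕ → (maxNilIdealC F).toIdeal} (ht0 : (t 0 : CBall F) = 0)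
    (htp : ∀ n, mulPC W (t (n + 1)) = t n) :
    BdRPlusTop.gal F p σ (omegaPeriod W hθ t ht0 htp) =
      omegaPeriod W hθ (AinfTop.galSeq F σ t) (AinfTop.coe_galSeq_zero σ ht0) (mulPC_galSeq W hθ σ htp) := by
  rw [omegaPeriod, omegaPeriod, FieldCoeff.gal_evalPt₁]
  congr 2
  exact Subtype.ext (gal_torsionLiftFil W σ ht0 htp)

/-- **`θ_dR(∫_t ω) = 0`**: the ω-period lies in the kernel of `θ_dR` (it lies in `Fil¹ = (ξ_dR) = ker θ_dR`).
[cite: FontaineAsterisque223III, Exp. II §1.5.2] -/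
theorem thetaBdR_omegaPeriod {t : ℕ → (maxNilIdealC F).toIdeal} (ht0 : (t 0 : CBall F) = 0)
    (htp : ∀ n, mulPC W (t (n + 1)) = t n) :
    thetaBdR ((BdRPlusTop.of F p).symm (omegaPeriod W hθ t ht0 htp)) = 0 :=
  (mem_ker_thetaBdR_iff _).2 ((BdRPlusTop.mem_filOne_iff).1 (omegaPeriod_mem_filOne W ht0 htp))

end AinfRamTop

end Literature.NumberTheory.PAdicHodge

end
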